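import Literature.NumberTheory.Rogawski1990.CMLocalAPacketMembers                 -- ★ `Gqs`, `qsForm`; brings ★ `cmLocalForm`, `cmLocalForm_eq_over`, `conjLocal_conjLocal_cm`
import Literature.NumberTheory.Automorphic.AnisotropicUnitaryGroupCompactOfPlace     -- ★ `conjLocal_apply_eq_of_smul_eq` (`(c ⊗ 1) y` read at `w` is `σ_w y_w`)
import Literature.NumberTheory.Automorphic.AdelicVectorHeightGalois                -- ★ `norm_galAdicCompletionMap` (`σ_w` is an isometry)
import Literature.NumberTheory.Automorphic.UnitaryGroupLocalCongr                   -- ★ `algebraMap_localRing_conj`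
import Literature.NumberTheory.Automorphic.UnitaryGroupNonsplitPlace                -- ★ `PlacesOver.subsingleton_of_smul_eq`
import HarnessLib

/-!
# An explicit bounded section of the regular semisimple stable classes of `U(Φ₂)(L⁺_v)` at a non-split place:
# `g(t, d) = [[0, (σk)⁻¹], [k, t]]` with the Hilbert-90 chart `k ∈ {1 − d, δ(1 + d)}` (Rogawski 1990 §3.1; Hilbert's Theorem 90)

Topic `NumberTheory/Rogawski1990`; namespace `Literature.NumberTheory.Rogawski1990`.  THEOREMS ONLY (no definition, no instance, no notation,
no named fact, no `sorry`).  Cell `pub/hodgecm-mathlib`, crux H413 = `stmt-HodgeConjecture-24833` (lane `--supports`), line LH6 «StCharTS», datum-road slice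
S13c «UP-DOM ⟸ UP-DEF» (map owner LH6-p01 (g4) SLICE WORD 11:59:07Z; seat LH4-p01 (g5)); FILE A of three (B = `LocalNormFibreBoundedReps`, C =
`Summits/…/Theorems/F0P3cStCharTSUpDom`).  HONEST LABEL: HC_CM is proved only modulo the 7 printed citations (2 remaining: hLiu418 =
`stmt-HodgeConjecture-24832`, h413 = `stmt-HodgeConjecture-24833`) until rung 0 closes; this file is unconditional local algebra, count-neutral.

THE MATHEMATICS.  `R = ∏_{w ∣ v} L_w` (★ `UnitaryGroup.LocalRing L v`), `σ = c ⊗ 1` (★ `conjLocal`), `v` non-split (one `w ∣ v`, so `R = L_w` is a field and `‖(σx)_w‖ = ‖x_w‖`).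
The local split form of rank two is `Φ₂ = antidiag(1, 1)` (§1, ★ `cmLocalForm_eq_over`), so `g = [[p, q], [r, s]] ∈ U(Φ₂)(L⁺_v)` iff
`σr·p + σp·r = 0`, `σr·q + σp·s = 1`, `σs·p + σq·r = 1`, `σs·q + σq·s = 0` (§1).  These give `σ(tr g)·det g = tr g` and `σ(det g)·det g = 1` (§2).  Conversely
(§3), for `t, d ∈ R` with `σd·d = 1`, `σt·d = t` and any `k` with `k = −d·σk`, `σk ∈ Rˣ`, the matrix **`[[0, (σk)⁻¹], [k, t]]`** lies in `U(Φ₂)(L⁺_v)` with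
trace `t`, determinant `d` and inverse `[[σd·t, −σd·(σk)⁻¹], [−σd·k, 0]]` — a division-free, `2`-free representative of the stable (= `GL₂(R)`-) class with
invariants `(t, d)`.  §4 supplies `k` by Hilbert 90 with UNIFORM bounds: `k = 1 − d` when `‖1 − d_w‖ ≥ ‖2‖∕2`, else `k = δ(1 + d)` for a fixed `δ = e − c e ≠ 0`
(`σδ = −δ`), so that `ε ≤ ‖k_w‖ ≤ C_k` with `ε = ‖2‖∕2 · min(1, ‖δ_w‖)`, `C_k = 2(1 + ‖δ_w‖)` depending on `(L, v)` only (triangle inequality from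
`(1 + d) + (1 − d) = 2`; no residue-characteristic hypothesis).  FILE B turns this into compact sets of representatives of the norm fibres.

## References
* [Rogawski1990] J. D. Rogawski, *Automorphic Representations of Unitary Groups in Three Variables*, Ann. of Math. Stud. 123 (1990): §3.1 p. 19 (stable conjugacy =
  `GL_n`-conjugacy), §1.9 p. 8 (`E_v = E ⊗ F_v`, the involution), §3.5 Prop. 3.5.2 p. 29.
* [CasselsFrohlichANT1967] J. W. S. Cassels, A. Fröhlich (eds.), *Algebraic Number Theory* (1967), Ch. VII §1.1 (completions at a non-split place); Hilbert's Theorem 90.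
-/

set_option autoImplicit false

noncomputable section

open NumberField IsDedekindDomain Matrix Polynomial Topology
open scoped MatrixGroups
open Literature.NumberTheory.Automorphic Literature.NumberTheory.Automorphic.UnitaryGroup

namespace Literature.NumberTheory.Rogawski1990

variable (L : Type) [Field L] [NumberField L] [IsCMField L] (v : HeightOneSpectrum (𝓞 ↥(maximalRealSubfield L)))

/-! ## §1 The local form `Φ₂ ⊗ 1 = antidiag(1,1)` and the membership equations of `U(Φ₂)(L⁺_v)` on entries -/

omit [IsCMField L] in
/-- The local split form of rank `2` is `antidiag(1, 1)` over `R = ∏_{w ∣ v} L_w`. [cite: Rogawski1990, §3.1 p. 19; §1.9 p. 8] -/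
theorem cmLocalForm_two_eq :
    cmLocalForm L 2 v = !![(0 : UnitaryGroup.LocalRing L v), 1; 1, 0] := by
  rw [cmLocalForm_eq_over]
  ext i j
  simp only [StdForm.over, Matrix.map_apply, StdForm.antidiagonal_J_apply]
  fin_cases i <;> fin_cases j <;> simp

/-- The four membership equations of `g ∈ U(Φ₂)(L⁺_v)` on the entries `p = g₀₀, q = g₀₁, r = g₁₀, s = g₁₁`:
`σr·p + σp·r = 0`, `σr·q + σp·s = 1`, `σs·p + σq·r = 1`, `σs·q + σq·s = 0`. [cite: Rogawski1990, §3.1 p. 19; §1.9 p. 8] -/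
theorem entries_of_mem_local_two (g : GL (Fin 2) (UnitaryGroup.LocalRing L v))
    (hg : g ∈ unitaryGroupOfForm (conjLocal L (IsCMField.complexConj L) v) (cmLocalForm L 2 v)) :
    conjLocal L (IsCMField.complexConj L) v (g.val 1 0) * g.val 0 0 + conjLocal L (IsCMField.complexConj L) v (g.val 0 0) * g.val 1 0 = 0 ∧
    conjLocal L (IsCMField.complexConj L) v (g.val 1 0) * g.val 0 1 + conjLocal L (IsCMField.complexConj L) v (g.val 0 0) * g.val 1 1 = 1 ∧
    conjLocal L (IsCMField.complexConj L) v (g.val 1 1) * g.val 0 0 + conjLocal L (IsCMField.complexConj L) v (g.val 0 1) * g.val 1 0 = 1 ∧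
    conjLocal L (IsCMField.complexConj L) v (g.val 1 1) * g.val 0 1 + conjLocal L (IsCMField.complexConj L) v (g.val 0 1) * g.val 1 1 = 0 := by
  have h : ((g : Matrix (Fin 2) (Fin 2) (UnitaryGroup.LocalRing L v)).map (conjLocal L (IsCMField.complexConj L) v))ᵀ * cmLocalForm L 2 v *
      (g : Matrix (Fin 2) (Fin 2) (UnitaryGroup.LocalRing L v)) = cmLocalForm L 2 v :=
    mem_unitaryGroupOfForm_iff.1 hg
  rw [cmLocalForm_two_eq] at h
  have e00 := congrFun (congrFun h 0) 0
  have e01 := congrFun (congrFun h 0) 1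
  have e10 := congrFun (congrFun h 1) 0
  have e11 := congrFun (congrFun h 1) 1
  simp [Matrix.mul_apply, Fin.sum_univ_two] at e00 e01 e10 e11
  exact ⟨e00, e01, e10, e11⟩

/-- Conversely, a matrix `g ∈ GL₂(R)` whose entries satisfy the four equations lies in `U(Φ₂)(L⁺_v)`. [cite: Rogawski1990, §3.1 p. 19; §1.9 p. 8] -/
theorem mem_local_two_of_entries (g : GL (Fin 2) (UnitaryGroup.LocalRing L v))
    (e00 : conjLocal L (IsCMField.complexConj L) v (g.val 1 0) * g.val 0 0 + conjLocal L (IsCMField.complexConj L) v (g.val 0 0) * g.val 1 0 = 0)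
    (e01 : conjLocal L (IsCMField.complexConj L) v (g.val 1 0) * g.val 0 1 + conjLocal L (IsCMField.complexConj L) v (g.val 0 0) * g.val 1 1 = 1)
    (e10 : conjLocal L (IsCMField.complexConj L) v (g.val 1 1) * g.val 0 0 + conjLocal L (IsCMField.complexConj L) v (g.val 0 1) * g.val 1 0 = 1)
    (e11 : conjLocal L (IsCMField.complexConj L) v (g.val 1 1) * g.val 0 1 + conjLocal L (IsCMField.complexConj L) v (g.val 0 1) * g.val 1 1 = 0) :
    g ∈ unitaryGroupOfForm (conjLocal L (IsCMField.complexConj L) v) (cmLocalForm L 2 v) := by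
  rw [mem_unitaryGroupOfForm_iff, cmLocalForm_two_eq]
  apply Matrix.ext
  intro i j
  fin_cases i <;> fin_cases j
  · simpa [Matrix.mul_apply, Fin.sum_univ_two] using e00
  · simpa [Matrix.mul_apply, Fin.sum_univ_two] using e01
  · simpa [Matrix.mul_apply, Fin.sum_univ_two] using e10
  · simpa [Matrix.mul_apply, Fin.sum_univ_two] using e11

/-! ## §2 Scalar algebra: `σ(tr g)·det g = tr g` and `σ(det g)·det g = 1` -/

section Scalar

variable {L v}

/-- `σ(p+s)·(ps − qr) = p + s` from the four membership equations. [cite: Rogawski1990, §3.1 p. 19; §1.9 p. 8] -/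
theorem conj_trace_mul_det_eq_trace_of_entries_two {p q r s : UnitaryGroup.LocalRing L v}
    (e00 : conjLocal L (IsCMField.complexConj L) v r * p + conjLocal L (IsCMField.complexConj L) v p * r = 0)
    (e01 : conjLocal L (IsCMField.complexConj L) v r * q + conjLocal L (IsCMField.complexConj L) v p * s = 1)
    (e10 : conjLocal L (IsCMField.complexConj L) v s * p + conjLocal L (IsCMField.complexConj L) v q * r = 1)
    (e11 : conjLocal L (IsCMField.complexConj L) v s * q + conjLocal L (IsCMField.complexConj L) v q * s = 0) :
    conjLocal L (IsCMField.complexConj L) v (p + s) * (p * s - q * r) = p + s := by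
  rw [map_add]
  linear_combination p * e01 + s * e10 - q * e00 - r * e11

/-- `σ(ps − qr)·(ps − qr) = 1` from the four membership equations. [cite: Rogawski1990, §3.1 p. 19; §1.9 p. 8] -/
theorem conj_det_mul_det_eq_one_of_entries_two {p q r s : UnitaryGroup.LocalRing L v}
    (e00 : conjLocal L (IsCMField.complexConj L) v r * p + conjLocal L (IsCMField.complexConj L) v p * r = 0)
    (e01 : conjLocal L (IsCMField.complexConj L) v r * q + conjLocal L (IsCMField.complexConj L) v p * s = 1)
    (e10 : conjLocal L (IsCMField.complexConj L) v s * p + conjLocal L (IsCMField.complexConj L) v q * r = 1)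
    (_e11 : conjLocal L (IsCMField.complexConj L) v s * q + conjLocal L (IsCMField.complexConj L) v q * s = 0) :
    conjLocal L (IsCMField.complexConj L) v (p * s - q * r) * (p * s - q * r) = 1 := by
  rw [map_sub, map_mul, map_mul]
  linear_combination (conjLocal L (IsCMField.complexConj L) v s * p + conjLocal L (IsCMField.complexConj L) v q * r) * e01 + e10 -
    (conjLocal L (IsCMField.complexConj L) v s * q + conjLocal L (IsCMField.complexConj L) v q * s) * e00

end Scalar

/-! ## §3 The explicit representative `[[0, (σk)⁻¹], [k, t]]` -/

section Rep

variable {L v}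

/-- Membership of an explicit `[[p, q], [r, s]]` with unit determinant from the four entry equations. [cite: Rogawski1990, §3.1 p. 19; §1.9 p. 8] -/
theorem nonsingInvUnit_mem_local_two (p q r s : UnitaryGroup.LocalRing L v) (hdet : IsUnit (!![p, q; r, s]).det)
    (e00 : conjLocal L (IsCMField.complexConj L) v r * p + conjLocal L (IsCMField.complexConj L) v p * r = 0)
    (e01 : conjLocal L (IsCMField.complexConj L) v r * q + conjLocal L (IsCMField.complexConj L) v p * s = 1)
    (e10 : conjLocal L (IsCMField.complexConj L) v s * p + conjLocal L (IsCMField.complexConj L) v q * r = 1)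
    (e11 : conjLocal L (IsCMField.complexConj L) v s * q + conjLocal L (IsCMField.complexConj L) v q * s = 0) :
    Matrix.nonsingInvUnit (!![p, q; r, s]) hdet ∈ unitaryGroupOfForm (conjLocal L (IsCMField.complexConj L) v) (cmLocalForm L 2 v) := by
  apply mem_local_two_of_entries
  all_goals simp [Matrix.nonsingInvUnit]
  · exact e00
  · exact e01
  · exact e10
  · exact e11

/-- **The explicit element.**  For `t d k : R` with `σd·d = 1`, `σt·d = t`, `k = −d·σk` and `σk` a unit (`e := (σk)⁻¹`), the matrix
`g = [[0, e],[k, t]]` lies in `U(Φ₂)(L⁺_v)`, has trace `t`, determinant `d`, and inverse `[[σd·t, −σd·e],[−σd·k, 0]]`. [cite: Rogawski1990, §3.1 p. 19; §1.9 p. 8] -/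
theorem exists_mem_local_two_of_invariants (t d k : UnitaryGroup.LocalRing L v)
    (hd : conjLocal L (IsCMField.complexConj L) v d * d = 1) (ht : conjLocal L (IsCMField.complexConj L) v t * d = t)
    (hk : k = -d * conjLocal L (IsCMField.complexConj L) v k) (hku : IsUnit (conjLocal L (IsCMField.complexConj L) v k)) :
    ∃ g : GL (Fin 2) (UnitaryGroup.LocalRing L v),
      g ∈ unitaryGroupOfForm (conjLocal L (IsCMField.complexConj L) v) (cmLocalForm L 2 v) ∧
      g.val = !![0, (↑(hku.unit⁻¹) : UnitaryGroup.LocalRing L v); k, t] ∧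
      (g⁻¹).val = !![conjLocal L (IsCMField.complexConj L) v d * t, -(conjLocal L (IsCMField.complexConj L) v d * ↑(hku.unit⁻¹));
                  -(conjLocal L (IsCMField.complexConj L) v d * k), 0] ∧
      g.val.trace = t ∧ g.val.det = d := by
  set σ := conjLocal L (IsCMField.complexConj L) v with hσ
  set e : UnitaryGroup.LocalRing L v := ↑(hku.unit⁻¹) with he
  have heσk : e * σ k = 1 := by rw [he]; exact hku.unit.inv_mul
  have hσke : σ k * e = 1 := by rw [mul_comm]; exact heσk
  -- `σ e · k = 1`
  have hσek : σ e * k = 1 := by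
    have h1 : σ (e * σ k) = 1 := by rw [heσk, map_one]
    rw [map_mul, hσ, conjLocal_conjLocal_cm] at h1
    exact h1
  have hkσe : k * σ e = 1 := by rw [mul_comm]; exact hσek
  -- `σ t · k = - t · σ k`
  have hσt : σ t * k = -(t * σ k) := by linear_combination (σ t) * hk - (σ k) * ht
  -- `k · e = -d`
  have hke : k * e = -d := by
    have : k * e = (-d * σ k) * e := by rw [← hk]
    rw [this]; linear_combination (-d) * hσke
  have hdetM : (!![0, e; k, t]).det = d := by
    rw [Matrix.det_fin_two_of]
    linear_combination (-1 : UnitaryGroup.LocalRing L v) * hke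
  have hdetU : IsUnit (!![0, e; k, t]).det := by
    rw [hdetM]
    exact isUnit_iff_exists_inv'.2 ⟨σ d, hd⟩
  refine ⟨Matrix.nonsingInvUnit _ hdetU, ?_, rfl, ?_, ?_, hdetM⟩
  · refine nonsingInvUnit_mem_local_two 0 e k t hdetU ?_ ?_ ?_ ?_
    · rw [map_zero, mul_zero, zero_mul, add_zero]
    · rw [map_zero, zero_mul, add_zero, hσke]
    · rw [mul_zero, zero_add, hσek]
    · -- `σt · e + σe · t = 0`: multiply by the unit `k · σk`
      have hkk : IsUnit (k * σ k) := (isUnit_iff_exists_inv.2 ⟨σ e, hkσe⟩).mul hku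
      refine (hkk.mul_left_eq_zero).1 ?_
      have h2 : (σ t * e + σ e * t) * (k * σ k) = (σ t * k) * (e * σ k) + (σ e * k) * (t * σ k) := by ring
      rw [h2, hσt, heσk, hσek]
      ring
  · -- the inverse, by `inv_eq_left_inv`
    have hinv : (Matrix.nonsingInvUnit (!![0, e; k, t]) hdetU)⁻¹.val = (!![0, e; k, t])⁻¹ := rfl
    rw [hinv]
    refine Matrix.inv_eq_left_inv ?_
    apply Matrix.ext
    intro i j
    fin_cases i <;> fin_cases j
    · simp [Matrix.mul_apply, Fin.sum_univ_two]
      linear_combination (-(σ d)) * hke + hd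
    · simp [Matrix.mul_apply, Fin.sum_univ_two]
      ring
    · simp [Matrix.mul_apply, Fin.sum_univ_two]
    · simp [Matrix.mul_apply, Fin.sum_univ_two]
      linear_combination (-(σ d)) * hke + hd
  · change Matrix.trace !![0, e; k, t] = t
    rw [Matrix.trace_fin_two_of]
    ring

end Rep

/-! ## §4 Norm bookkeeping at the (unique) place `w ∣ v` and the Hilbert-90 chart `k ∈ {1 − d, δ(1 + d)}` -/

section Chart

variable {L v}
variable (w : UnitaryGroup.PlacesOver L v) (hw : IsCMField.complexConj L • w.1 = w.1)

include hw in
/-- `‖(σ x)_w‖ = ‖x_w‖` at a non-split place. [cite: Rogawski1990, §3.1 p. 19; §1.9 p. 8] -/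
theorem norm_conjLocal_apply (x : UnitaryGroup.LocalRing L v) :
    ‖conjLocal L (IsCMField.complexConj L) v x w‖ = ‖x w‖ := by
  haveI : Algebra.IsQuadraticExtension ↥(maximalRealSubfield L) L := IsCMField.isQuadraticExtension L
  rw [conjLocal_apply_eq_of_smul_eq (IsCMField.complexConj L) (IsCMField.complexConj_ne_one L) v w hw x,
    norm_galAdicCompletionMap]

include hw in
/-- `σd·d = 1 ⇒ ‖d_w‖ = 1`. [cite: Rogawski1990, §3.1 p. 19; §1.9 p. 8] -/
theorem norm_apply_eq_one_of_conj_mul_self {d : UnitaryGroup.LocalRing L v}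
    (hd : conjLocal L (IsCMField.complexConj L) v d * d = 1) : ‖d w‖ = 1 := by
  have h := congrFun hd w
  rw [Pi.mul_apply, Pi.one_apply] at h
  have hn : ‖conjLocal L (IsCMField.complexConj L) v d w‖ * ‖d w‖ = 1 := by rw [← norm_mul, h, norm_one]
  rw [norm_conjLocal_apply w hw] at hn
  have h0 : 0 ≤ ‖d w‖ := norm_nonneg _
  nlinarith [hn, h0]

omit [IsCMField L] in
/-- An element of `R` all of whose components are non-zero is a unit. [cite: Rogawski1990, §3.1 p. 19; §1.9 p. 8] -/
theorem isUnit_localRing_of_forall_apply_ne_zero {k : UnitaryGroup.LocalRing L v} (hk : ∀ w', k w' ≠ 0) : IsUnit k :=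
  isUnit_iff_exists_inv.2 ⟨fun w' => (k w')⁻¹, funext fun w' => mul_inv_cancel₀ (hk w')⟩

include hw in
/-- **The chart constants.**  There are `ε > 0` and `C_k` (depending on `L, v` only) such that every `d ∈ R` with `σd·d = 1` admits `k ∈ R` with
`k = −d·σk`, `k` a unit, and `ε ≤ ‖k_w‖ ≤ C_k` (`k = 1 − d` if `‖1 − d_w‖ ≥ ‖2‖∕2`, else `k = δ(1 + d)` with `σδ = −δ`). [cite: Rogawski1990, §3.1 p. 19; §1.9 p. 8] -/
theorem exists_hilbert90_chart_constants :
    ∃ ε Ck : ℝ, 0 < ε ∧ ∀ d : UnitaryGroup.LocalRing L v, conjLocal L (IsCMField.complexConj L) v d * d = 1 →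
      ∃ k : UnitaryGroup.LocalRing L v, k = -d * conjLocal L (IsCMField.complexConj L) v k ∧ IsUnit k ∧ ε ≤ ‖k w‖ ∧ ‖k w‖ ≤ Ck := by
  haveI : Algebra.IsQuadraticExtension ↥(maximalRealSubfield L) L := IsCMField.isQuadraticExtension L
  haveI : Subsingleton (UnitaryGroup.PlacesOver L v) :=
    PlacesOver.subsingleton_of_smul_eq (IsCMField.complexConj L) (IsCMField.complexConj_ne_one L) w hw
  set σ := conjLocal L (IsCMField.complexConj L) v with hσ
  -- an anti-invariant unit `δ`
  obtain ⟨e, he⟩ : ∃ e : L, IsCMField.complexConj L e ≠ e := by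
    by_contra h
    exact IsCMField.complexConj_ne_one L (AlgEquiv.ext fun x => not_ne_iff.mp (not_exists.mp h x))
  set δL : L := e - IsCMField.complexConj L e with hδL
  have hδL0 : δL ≠ 0 := sub_ne_zero.2 (Ne.symm he)
  have hcδL : IsCMField.complexConj L δL = -δL := by
    rw [hδL, map_sub, IsCMField.complexConj_apply_apply, neg_sub]
  set δ : UnitaryGroup.LocalRing L v := algebraMap L (UnitaryGroup.LocalRing L v) δL with hδ
  have hσδ : σ δ = -δ := by
    rw [hδ, hσ, ← algebraMap_localRing_conj L (IsCMField.complexConj L) v δL]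
    change algebraMap L (UnitaryGroup.LocalRing L v) (IsCMField.complexConj L δL) = _
    rw [hcδL, map_neg]
  have hδw : δ w = algebraMap L (w.1.adicCompletion L) δL := by
    rw [hδ, Pi.algebraMap_apply]
  have hδ0 : δ w ≠ 0 := by
    rw [hδw]
    exact (map_ne_zero_iff _ (RingHom.injective _)).2 hδL0
  have hNδ : 0 < ‖δ w‖ := norm_pos_iff.2 hδ0
  have hN2 : 0 < ‖(2 : w.1.adicCompletion L)‖ := norm_pos_iff.2 two_ne_zero
  refine ⟨‖(2 : w.1.adicCompletion L)‖ / 2 * min 1 ‖δ w‖, 2 * (1 + ‖δ w‖), by positivity, fun d hd => ?_⟩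
  have hdn : ‖d w‖ = 1 := norm_apply_eq_one_of_conj_mul_self w hw hd
  have hdd : d * σ d = 1 := by rw [mul_comm]; exact hd
  have hmin1 : min 1 ‖δ w‖ ≤ 1 := min_le_left _ _
  have hminδ : min 1 ‖δ w‖ ≤ ‖δ w‖ := min_le_right _ _
  have hmin0 : 0 < min 1 ‖δ w‖ := lt_min one_pos hNδ
  by_cases hcase : ‖(2 : w.1.adicCompletion L)‖ / 2 ≤ ‖(1 - d) w‖
  · -- chart `k = 1 − d`
    refine ⟨1 - d, ?_, ?_, ?_, ?_⟩
    · rw [map_sub, map_one]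
      linear_combination (-1 : UnitaryGroup.LocalRing L v) * hdd
    · refine isUnit_localRing_of_forall_apply_ne_zero fun w' => ?_
      rw [Subsingleton.elim w' w]
      intro h0
      rw [h0, norm_zero] at hcase
      linarith
    · calc ‖(2 : w.1.adicCompletion L)‖ / 2 * min 1 ‖δ w‖ ≤ ‖(2 : w.1.adicCompletion L)‖ / 2 * 1 := by gcongr
        _ ≤ ‖(1 - d) w‖ := by rw [mul_one]; exact hcase
    · rw [Pi.sub_apply, Pi.one_apply]
      calc ‖1 - d w‖ ≤ ‖(1 : w.1.adicCompletion L)‖ + ‖d w‖ := norm_sub_le _ _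
        _ = 2 := by rw [norm_one, hdn]; norm_num
        _ ≤ 2 * (1 + ‖δ w‖) := by nlinarith [hNδ]
  · -- chart `k = δ(1 + d)`
    have hcase' : ‖(1 - d) w‖ < ‖(2 : w.1.adicCompletion L)‖ / 2 := not_le.1 hcase
    have hplus : ‖(2 : w.1.adicCompletion L)‖ / 2 ≤ ‖(1 + d) w‖ := by
      have h2 : (2 : w.1.adicCompletion L) = (1 + d) w + (1 - d) w := by
        rw [Pi.add_apply, Pi.sub_apply, Pi.one_apply]; ring
      have := norm_add_le ((1 + d) w) ((1 - d) w)
      rw [← h2] at this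
      linarith [hcase']
    refine ⟨δ * (1 + d), ?_, ?_, ?_, ?_⟩
    · rw [map_mul, hσδ, map_add, map_one]
      linear_combination (-δ) * hdd
    · refine isUnit_localRing_of_forall_apply_ne_zero fun w' => ?_
      rw [Subsingleton.elim w' w, Pi.mul_apply]
      refine mul_ne_zero hδ0 fun h0 => ?_
      rw [h0, norm_zero] at hplus
      linarith
    · rw [Pi.mul_apply, norm_mul]
      calc ‖(2 : w.1.adicCompletion L)‖ / 2 * min 1 ‖δ w‖ ≤ ‖(2 : w.1.adicCompletion L)‖ / 2 * ‖δ w‖ := by gcongr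
        _ = ‖δ w‖ * (‖(2 : w.1.adicCompletion L)‖ / 2) := by ring
        _ ≤ ‖δ w‖ * ‖(1 + d) w‖ := by gcongr
    · rw [Pi.mul_apply, norm_mul, Pi.add_apply, Pi.one_apply]
      calc ‖δ w‖ * ‖1 + d w‖ ≤ ‖δ w‖ * (‖(1 : w.1.adicCompletion L)‖ + ‖d w‖) := by gcongr; exact norm_add_le _ _
        _ = ‖δ w‖ * 2 := by rw [norm_one, hdn]; norm_num
        _ ≤ 2 * (1 + ‖δ w‖) := by nlinarith [hNδ]

end Chart

end Literature.NumberTheory.Rogawski1990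

end
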